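import Summits.BirchSwinnertonDyer.BirchSwinnertonDyer.Theorems.BiquadraticEisensteinDescentManinDatumSupercuspidalCMInertCMModelsQuartic
import Summits.BirchSwinnertonDyer.BirchSwinnertonDyer.Theorems.BiquadraticEisensteinDescentManinDatumSupercuspidalCMInertCMModelsSextic
import Summits.BirchSwinnertonDyer.BirchSwinnertonDyer.Theorems.BiquadraticEisensteinDescentManinDatumSupercuspidalCMInertPointwiseLever
import Summits.BirchSwinnertonDyer.BirchSwinnertonDyer.Theorems.InertBadSignedBranchesInertBadAtThreeQuarticValueExit
import Summits.BirchSwinnertonDyer.BirchSwinnertonDyer.Theses.BiquadraticEisensteinDescent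
import HarnessLib

set_option linter.dupNamespace false -- `Summit.BirchSwinnertonDyer.BirchSwinnertonDyer.Theorems.…` (summit = sub, D-0017)
set_option autoImplicit false

/-!
# Crux `ManinDatumSupercuspidalCMInert` (stmt-BirchSwinnertonDyer-20111, BED r605): the registered stubs `stub_S5` / `stub_S7` and the
# route decl from `f`-FREE, MODEL-LEVEL odd twisted `L`-values of the CM families `y² = x³ + k` (`5 ∣ k`) / `y² = x³ + Ax` (`7 ∣ A`)
# — no named fact (width seat `bsd-wall-cm-bed-w2` g10; theorems only; `--supports 20111`, helper)

Route `BiquadraticEisensteinDescent` (cell `pub/bsd-wall`, D-0152 M1). Composition of three width lanes on crux R₅₇-supercuspidal (skeleton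
`9438078f…`, stubs `stub_S5` = `j = 0` @ `5`, `stub_S7` = `j = 1728` @ `7`, hitherto closed only MODULO Kato's derived-reading fact F″,
`…ManinDatumSupercuspidalCMInertOfKato`):

* E-side (bsd-wall-cm-bed-w4 g10, p634645): `…PointwiseLever.not_dvd_c_of_oddPrimeInstances57` — Manin's `p`-part at a lattice-optimal datum,
  `p ∈ {5, 7}`, from the plain `p`-integrality in Néron units of the ODD twisted symbol sums `Σ_a χ(a){∞, a/d′}_{D.f}` at the auxiliary primes
  `d′ > N`, `d′ ≡ 3 (4)`, `p ∤ d′ − 1`, `r ∤ d′ − 1` (odd `r ∣ p − 1`), `p` a square mod `d′`;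
* model lane (this seat, `…CMInertCMModelsQuartic` / `…CMInertCMModelsSextic`): the power-free CM models with `p`-adic unit scaling;
* value exit / transport (bsd-wall-cm-bed-w3 g8 at `p = 3`, prime-generic): Birch's formula `τ(χ)·L(f, χ̄, 1) = Σ_a χ(a){∞, a/m}_f`
  (`ModularForms.twisted_LValue_eq_holds`) and `…QuarticModel.LValueOdd_of_smul` (`a_n(C • V) = a_n(V)`, `Ω⁻(C • V) = |u|·Ω⁻(V)`).

RESULTS (theorems only):
* `oddInstance_of_LValue` — for ANY elliptic `W`, newform `f` of `W` at any level, prime `p`, primitive `χ`: the lever's currency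
  `∃ s, p ∤ s, s·Σ_aχ(a){∞,a/m}_f/(Ω⁻(W)·i) ∈ ℤ̄` follows from the `f`-free «some entire `L` continuing `Σ χ̄(n)a_n(W)n⁻ˢ` has
  `s·τ(χ)·L(1)/(i·Ω⁻(W)) ∈ ℤ̄`, `p ∤ s`».
* ★ `stub_S7_of_modelOddLValues` — the registered signature of `stub_S7` VERBATIM from **H₇**: for every fourth-power-free `A ∈ ℤ ∖ 0` with
  `7 ∣ A`, every prime `ℓ ∤ 2A` with `ℓ ≡ 3 (4)`, `ℓ ≢ 1 (7)`, `ℓ ≢ 1 (3)`, `7` a square mod `ℓ`, every odd `χ` mod `ℓ`: some entire `L`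
  continuing `Σ χ̄(n)a_n(E_A)n⁻ˢ` (`E_A = ⟨0,0,0,A,0⟩`) has `s·τ(χ)·L(1)/(i·Ω⁻(E_A)) ∈ ℤ̄` with `7 ∤ s`.
* ★ `stub_S5_of_modelOddLValues` — the registered signature of `stub_S5` VERBATIM from **H₅**: the same for the sixth-power-free Mordell
  models `E^k = ⟨0,0,0,0,k⟩`, `5 ∣ k`, primes `ℓ ∤ k`, `ℓ ≥ 5`, `ℓ ≡ 3 (4)`, `ℓ ≢ 1 (5)`, `5` a square mod `ℓ`, odd `χ` mod `ℓ`, `5 ∤ s`.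
* `maninDatumSupercuspidalCMInert_of_modelOddLValues` — THE ROUTE DECL `ManinDatumSupercuspidalCMInert` BY NAME from H₅ ∧ H₇.

So the Manin input R₅₇ of route BED on its two supercuspidal CM cells asks the CM side for `L`-VALUES OF THE EXPLICIT CM FAMILIES ONLY
(the `p ∈ {5, 7}` twins of the PROVED `p = 3` quartic statement `…InertBadAtThreeQuarticCell.neronIntegralThreeQuartic`, p633908):
over `ℤ[i]` at the inert `7` (theta dictionary of `y² = x³ + Ax`: tree `QuarticTwist.lSeries_twist_eq_thetaLFunction`) and over `ℤ[ω]` at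
the inert `5`. HONEST FRAMING: H₅ / H₇ are NOT proved here or anywhere in the tree (their CM core is the tame resolvent count in
`ℚ(ω)(E[5])` / `ℚ(i)(E[7])`, not the `p = 3` closed forms); nothing here proves the stubs, the crux, Manin's conjecture or BSD. No
definition, no named fact, no `sorry`; axioms standard.
-/

noncomputable section

open scoped Classical MatrixGroups

open Complex WeierstrassCurve IsDedekindDomain NumberField
open Literature.NumberTheory.EllipticCurves Literature.NumberTheory.EllipticCurves.ModularForms
open Literature.NumberTheory.EllipticCurves.Rank1Residual
open Literature.NumberTheory.DiophantineGeometry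
open Summit.BirchSwinnertonDyer.BirchSwinnertonDyer.Theses.BiquadraticEisensteinDescent

namespace Summit.BirchSwinnertonDyer.BirchSwinnertonDyer.Theorems.BiquadraticEisensteinDescentManinDatumSupercuspidalCMInertStubsOfModelLValues

open Summit.BirchSwinnertonDyer.BirchSwinnertonDyer.Theorems.ManinLocalTwoThree (isPrimitive_of_odd)
open Summit.BirchSwinnertonDyer.BirchSwinnertonDyer.Theorems.InertBadSignedBranchesInertBadAtThreeQuarticValueExit
  (twistedLSeries_eq_of_isNewformOf)
open Summit.BirchSwinnertonDyer.BirchSwinnertonDyer.Theorems.InertBadSignedBranchesInertBadAtThreeQuarticModel (LValueOdd_of_smul)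
open Summit.BirchSwinnertonDyer.BirchSwinnertonDyer.Theorems.InertBadSignedBranchesInertBadAtThreeQuarticModelUnit
  (not_dvd_quartic_of_not_dvd_conductorNorm)
open Summit.BirchSwinnertonDyer.BirchSwinnertonDyer.Theorems.BiquadraticEisensteinDescentManinDatumSupercuspidalCMInertCMModelsQuartic
  (exists_smul_eq_quartic_fourthPowerFree_of_ne_two)
open Summit.BirchSwinnertonDyer.BirchSwinnertonDyer.Theorems.BiquadraticEisensteinDescentManinDatumSupercuspidalCMInertCMModelsSextic
  (exists_smul_eq_sextic_sixthPowerFree not_dvd_sextic_of_not_dvd_conductorNorm)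
open Summit.BirchSwinnertonDyer.BirchSwinnertonDyer.Theorems.BiquadraticEisensteinDescentManinDatumSupercuspidalCMInertPointwiseLever
  (not_dvd_c_of_oddPrimeInstances57)

/-! ## §1 The lever's currency from the `f`-free twisted `L`-value (Birch) -/

section Birch

variable {N : ℕ} [NeZero N] {m : ℕ} [NeZero m] {p : ℕ}
  (W : WeierstrassCurve ℚ) {f : CuspForm (CongruenceSubgroup.Gamma0 N) 2}

/-- ★ **The pointwise lever's currency from the `f`-free odd `L`-value.** `f` the newform of `W` at ANY level, `χ` primitive mod `m`: if SOME
entire `L` with `L(s) = Σ χ̄(n)a_n(W)n⁻ˢ` (`re s > 2`) has `s·τ(χ)·L(1)/(i·Ω⁻(W)) ∈ ℤ̄` with `p ∤ s`, then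
`s·Σ_aχ(a){∞,a/m}_f/(Ω⁻(W)·i) ∈ ℤ̄` — Birch's formula `τ(χ)·L(f, χ̄, 1) = Σ_aχ(a){∞,a/m}_f` holds for every entire continuation
(`ModularForms.twisted_LValue_eq_holds`) and `a_n(f) = a_n(W)`. [cite: MazurTateTeitelbaum1986, §I.8 (8.6)] -/
theorem oddInstance_of_LValue (hf : IsNewformOf W f) {χ : DirichletCharacter ℂ m} (hχ : χ.IsPrimitive)
    (hint : ∃ L : ℂ → ℂ, Differentiable ℂ L ∧
      (∀ s : ℂ, 2 < s.re → L s = LSeries (fun n : ℕ ↦ χ⁻¹ (n : ZMod m) * (W.LFunction n : ℂ)) s) ∧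
      ∃ s : ℕ, ¬ p ∣ s ∧ IsIntegral ℤ ((s : ℂ) *
        (gaussSum χ (ZMod.stdAddChar (N := m)) * L 1 / (Complex.I * (W.imaginaryPeriodRat : ℂ))))) :
    ∃ s : ℕ, ¬ p ∣ s ∧ IsIntegral ℤ ((s : ℂ) * (twistedSymbolSum f χ / ((W.imaginaryPeriodRat : ℂ) * Complex.I))) := by
  obtain ⟨L, hLd, hLs, s, hps, hsint⟩ := hint
  refine ⟨s, hps, ?_⟩
  have hLs' : ∀ z : ℂ, 2 < z.re → L z = twistedLSeries f χ⁻¹ z := fun z hz ↦ by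
    rw [hLs z hz, twistedLSeries_eq_of_isNewformOf W hf]
  have hBirch : gaussSum χ (ZMod.stdAddChar (N := m)) * L 1 = twistedSymbolSum f χ := by
    have h := twisted_LValue_eq_holds f (m := m) (isPrimitive_inv hχ) hLd hLs'
    rwa [inv_inv] at h
  rw [← hBirch, mul_comm (W.imaginaryPeriodRat : ℂ) Complex.I]
  exact hsint

end Birch

/-! ## §2 `stub_S7` (`j = 1728` @ `7`) from the quartic models' odd `L`-values -/

/-- ★ **Registered stub `stub_S7` of skeleton `9438078f…` (signature VERBATIM) from the MODEL-level odd twisted-value `7`-integrality H₇.**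
For `W/ℚ` globally minimal CM of analytic rank one, `p = 7`, `j(W) = 1728`, `7` inert in the CM field and bad, `D` a lattice-optimal
`X₀(N_W)`-datum, place `v` over `7` of type III/III*: `7 ∤ c(D)`. Chain: fourth-power-free quartic model `C • W = E_A` with `7 ∣ A`, `v₇(u_C) = 0`
(`…CMModelsQuartic`); the auxiliary primes `d′ > N_W` of the lever are `∤ N_W`, hence `∤ A` (`not_dvd_quartic_of_not_dvd_conductorNorm`); H₇ at
`(A, d′, χ)`; transport `LValueOdd_of_smul`; Birch (`oddInstance_of_LValue`); bed-w4 g10's `not_dvd_c_of_oddPrimeInstances57`. The rank, CM-inert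
and Kodaira binders are idle. [cite: SilvermanAEC2009, X.5.4 (iii)] [cite: MazurTateTeitelbaum1986, §I.8 (8.6)] [cite: Manin1972, Thm. 1.6] -/
theorem stub_S7_of_modelOddLValues
    (H₇ : ∀ (A : ℤ), A ≠ 0 → (7 : ℤ) ∣ A → (∀ q : ℕ, q.Prime → ¬ ((q : ℤ) ^ 4 ∣ A)) →
      ∀ (ℓ : ℕ) [NeZero ℓ], ℓ.Prime → ℓ ≠ 2 → ¬ (ℓ : ℤ) ∣ A → ¬ 4 ∣ ℓ - 1 → ¬ 7 ∣ ℓ - 1 → ¬ 3 ∣ ℓ - 1 →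
        IsSquare ((7 : ℕ) : ZMod ℓ) →
      ∀ χ : DirichletCharacter ℂ ℓ, χ.Odd →
      ∃ L : ℂ → ℂ, Differentiable ℂ L ∧
        (∀ s : ℂ, 2 < s.re → L s = LSeries (fun n : ℕ ↦ χ⁻¹ (n : ZMod ℓ) *
          ((⟨0, 0, 0, (A : ℚ), 0⟩ : WeierstrassCurve ℚ).LFunction n : ℂ)) s) ∧
        ∃ s : ℕ, ¬ 7 ∣ s ∧ IsIntegral ℤ ((s : ℂ) * (gaussSum χ (ZMod.stdAddChar (N := ℓ)) * L 1 /
          (Complex.I * ((⟨0, 0, 0, (A : ℚ), 0⟩ : WeierstrassCurve ℚ).imaginaryPeriodRat : ℂ))))) :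
    ∀ (W : WeierstrassCurve ℚ) [W.IsElliptic] [W.IsGloballyMinimal] [NeZero (W.conductorNorm ℤ)] (p : ℕ)
      [Fact p.Prime] (D : ModularParametrizationData W (W.conductorNorm ℤ)) (v : IsDedekindDomain.HeightOneSpectrum ℤ),
      Rat.HeightOneSpectrum.natGenerator v = p → W.HasCM → W.analyticRank = 1 → p = 7 → W.j = 1728 →
      CMInert W p → ¬ Good W p → (∀ z ∈ D.L.lattice, ∃ w ∈ periodLattice D.f, z = D.c * w) →
      (W.kodairaSymbolAt v = .III ∨ W.kodairaSymbolAt v = .IIIstar) → ¬ (p : ℤ) ∣ D.c := by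
  intro W _ _ _ p _ D v _hv _hCM _hr hp7 hj _hin hbad hopt _hk
  subst hp7
  have hbad' : ¬ W.HasGoodReductionAtPrime 7 := hbad
  obtain ⟨A, C, hCV, hA0, h7A, h4, hu⟩ := exists_smul_eq_quartic_fourthPowerFree_of_ne_two (p := 7) (by norm_num) W hj hbad'
  have hpN : 7 ∣ W.conductorNorm ℤ := (W.dvd_conductorNorm_iff_not_hasGoodReductionAtPrime 7).mpr hbad'
  have hN0 : 0 < W.conductorNorm ℤ := Nat.pos_of_ne_zero (NeZero.ne _)
  refine not_dvd_c_of_oddPrimeInstances57 (p := 7) (Or.inr rfl) W D hopt hpN ?_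
  intro d' _ hd' hNd' h7d' hrd' h4d' hsq χ hχ
  haveI : Fact d'.Prime := ⟨hd'⟩
  -- `d′ ∤ N_W` (as `d′ > N_W`), `d′ ≠ 2` (as `7 ∣ N_W < d′`), hence `d′ ∤ A`
  have hd'N : ¬ d' ∣ W.conductorNorm ℤ := fun h ↦ absurd hNd' (not_lt.mpr (Nat.le_of_dvd hN0 h))
  have h7N : 7 ≤ W.conductorNorm ℤ := Nat.le_of_dvd hN0 hpN
  have hd'2 : d' ≠ 2 := by omega
  have hd'A : ¬ (d' : ℤ) ∣ A := not_dvd_quartic_of_not_dvd_conductorNorm W hCV h4 hd' hd'2 hd'N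
  have h3d' : ¬ 3 ∣ d' - 1 := hrd' 3 Nat.prime_three (by norm_num) (by norm_num)
  have hsq' : IsSquare ((7 : ℕ) : ZMod d') := by
    rcases hsq with h | h
    · omega
    · exact h
  have hmodel := H₇ A hA0 h7A h4 d' hd' hd'2 hd'A h4d' h7d' h3d' hsq' χ hχ
  have hV := LValueOdd_of_smul (p := 7) W C (KramerTwoDescent.not_dvd_den_of_padicValRat_eq_zero hu) χ
    (by rw [hCV]; exact hmodel)
  exact oddInstance_of_LValue W D.isNewformOf (isPrimitive_of_odd hχ) hV

/-! ## §3 `stub_S5` (`j = 0` @ `5`) from the Mordell models' odd `L`-values -/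

/-- ★ **Registered stub `stub_S5` of skeleton `9438078f…` (signature VERBATIM) from the MODEL-level odd twisted-value `5`-integrality H₅.**
For `W/ℚ` globally minimal CM of analytic rank one, `p = 5`, `j(W) = 0`, `5` inert in the CM field and bad, `D` a lattice-optimal `X₀(N_W)`-datum,
place `v` over `5` of type II/IV/IV*/II*: `5 ∤ c(D)`. Chain: sixth-power-free Mordell model `C • W = E^k = ⟨0,0,0,0,k⟩` with `5 ∣ k`,
`v₅(u_C) = 0` (`…CMModelsSextic`); the lever's primes `d′ > N_W ≥ 25` are `∤ N_W`, hence `∤ k` (`not_dvd_sextic_of_not_dvd_conductorNorm`); H₅;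
`LValueOdd_of_smul`; Birch; `not_dvd_c_of_oddPrimeInstances57` (no odd prime divides `5 − 1`). Rank, CM-inert and Kodaira binders idle.
[cite: SilvermanAEC2009, X.5.4 (iii)] [cite: MazurTateTeitelbaum1986, §I.8 (8.6)] [cite: Manin1972, Thm. 1.6] -/
theorem stub_S5_of_modelOddLValues
    (H₅ : ∀ (k : ℤ), k ≠ 0 → (5 : ℤ) ∣ k → (∀ q : ℕ, q.Prime → ¬ ((q : ℤ) ^ 6 ∣ k)) →
      ∀ (ℓ : ℕ) [NeZero ℓ], ℓ.Prime → 5 ≤ ℓ → ¬ (ℓ : ℤ) ∣ k → ¬ 4 ∣ ℓ - 1 → ¬ 5 ∣ ℓ - 1 →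
        IsSquare ((5 : ℕ) : ZMod ℓ) →
      ∀ χ : DirichletCharacter ℂ ℓ, χ.Odd →
      ∃ L : ℂ → ℂ, Differentiable ℂ L ∧
        (∀ s : ℂ, 2 < s.re → L s = LSeries (fun n : ℕ ↦ χ⁻¹ (n : ZMod ℓ) *
          ((⟨0, 0, 0, 0, (k : ℚ)⟩ : WeierstrassCurve ℚ).LFunction n : ℂ)) s) ∧
        ∃ s : ℕ, ¬ 5 ∣ s ∧ IsIntegral ℤ ((s : ℂ) * (gaussSum χ (ZMod.stdAddChar (N := ℓ)) * L 1 /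
          (Complex.I * ((⟨0, 0, 0, 0, (k : ℚ)⟩ : WeierstrassCurve ℚ).imaginaryPeriodRat : ℂ))))) :
    ∀ (W : WeierstrassCurve ℚ) [W.IsElliptic] [W.IsGloballyMinimal] [NeZero (W.conductorNorm ℤ)] (p : ℕ)
      [Fact p.Prime] (D : ModularParametrizationData W (W.conductorNorm ℤ)) (v : IsDedekindDomain.HeightOneSpectrum ℤ),
      Rat.HeightOneSpectrum.natGenerator v = p → W.HasCM → W.analyticRank = 1 → p = 5 → W.j = 0 →
      CMInert W p → ¬ Good W p → (∀ z ∈ D.L.lattice, ∃ w ∈ periodLattice D.f, z = D.c * w) →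
      (W.kodairaSymbolAt v = .II ∨ W.kodairaSymbolAt v = .IV ∨ W.kodairaSymbolAt v = .IVstar ∨
        W.kodairaSymbolAt v = .IIstar) → ¬ (p : ℤ) ∣ D.c := by
  intro W _ _ _ p _ D v _hv _hCM _hr hp5 hj _hin hbad hopt _hk
  subst hp5
  have hbad' : ¬ W.HasGoodReductionAtPrime 5 := hbad
  obtain ⟨k, C, hCV, hk0, h5k, h6, hu⟩ := exists_smul_eq_sextic_sixthPowerFree (p := 5) le_rfl W hj hbad'
  have hpN : 5 ∣ W.conductorNorm ℤ := (W.dvd_conductorNorm_iff_not_hasGoodReductionAtPrime 5).mpr hbad'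
  have hN0 : 0 < W.conductorNorm ℤ := Nat.pos_of_ne_zero (NeZero.ne _)
  refine not_dvd_c_of_oddPrimeInstances57 (p := 5) (Or.inl rfl) W D hopt hpN ?_
  intro d' _ hd' hNd' h5d' _hrd' h4d' hsq χ hχ
  haveI : Fact d'.Prime := ⟨hd'⟩
  -- `d′ ∤ N_W` (as `d′ > N_W`), `d′ ≥ 5` (as `5 ∣ N_W < d′`), hence `d′ ∤ k`
  have hd'N : ¬ d' ∣ W.conductorNorm ℤ := fun h ↦ absurd hNd' (not_lt.mpr (Nat.le_of_dvd hN0 h))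
  have h5N : 5 ≤ W.conductorNorm ℤ := Nat.le_of_dvd hN0 hpN
  have hd'5 : 5 ≤ d' := by omega
  have hd'k : ¬ (d' : ℤ) ∣ k := not_dvd_sextic_of_not_dvd_conductorNorm W hCV h6 hd' hd'5 hd'N
  have hsq' : IsSquare ((5 : ℕ) : ZMod d') := by
    rcases hsq with h | h
    · omega
    · exact h
  have hmodel := H₅ k hk0 h5k h6 d' hd' hd'5 hd'k h4d' h5d' hsq' χ hχ
  have hV := LValueOdd_of_smul (p := 5) W C (KramerTwoDescent.not_dvd_den_of_padicValRat_eq_zero hu) χ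
    (by rw [hCV]; exact hmodel)
  exact oddInstance_of_LValue W D.isNewformOf (isPrimitive_of_odd hχ) hV

/-! ## §4 The route decl by name -/

/-- ★ **The crux `ManinDatumSupercuspidalCMInert` (stmt-BirchSwinnertonDyer-20111) — THE ROUTE DECL BY NAME — from H₅ ∧ H₇** (the registered
skeleton's composition: the two cells are the two stubs). A CONDITIONAL closer with NO named fact: the item's research content is now the
odd twisted `L`-value `p`-integrality of the two explicit CM families at their inert prime `p ∈ {5, 7}`. BSD is not proved by any of this.
[cite: SilvermanAEC2009, X.5.4 (iii)] [cite: MazurTateTeitelbaum1986, §I.8 (8.6)] [cite: Manin1972, Thm. 1.6] -/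
theorem maninDatumSupercuspidalCMInert_of_modelOddLValues
    (H₅ : ∀ (k : ℤ), k ≠ 0 → (5 : ℤ) ∣ k → (∀ q : ℕ, q.Prime → ¬ ((q : ℤ) ^ 6 ∣ k)) →
      ∀ (ℓ : ℕ) [NeZero ℓ], ℓ.Prime → 5 ≤ ℓ → ¬ (ℓ : ℤ) ∣ k → ¬ 4 ∣ ℓ - 1 → ¬ 5 ∣ ℓ - 1 →
        IsSquare ((5 : ℕ) : ZMod ℓ) →
      ∀ χ : DirichletCharacter ℂ ℓ, χ.Odd →
      ∃ L : ℂ → ℂ, Differentiable ℂ L ∧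
        (∀ s : ℂ, 2 < s.re → L s = LSeries (fun n : ℕ ↦ χ⁻¹ (n : ZMod ℓ) *
          ((⟨0, 0, 0, 0, (k : ℚ)⟩ : WeierstrassCurve ℚ).LFunction n : ℂ)) s) ∧
        ∃ s : ℕ, ¬ 5 ∣ s ∧ IsIntegral ℤ ((s : ℂ) * (gaussSum χ (ZMod.stdAddChar (N := ℓ)) * L 1 /
          (Complex.I * ((⟨0, 0, 0, 0, (k : ℚ)⟩ : WeierstrassCurve ℚ).imaginaryPeriodRat : ℂ)))))
    (H₇ : ∀ (A : ℤ), A ≠ 0 → (7 : ℤ) ∣ A → (∀ q : ℕ, q.Prime → ¬ ((q : ℤ) ^ 4 ∣ A)) →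
      ∀ (ℓ : ℕ) [NeZero ℓ], ℓ.Prime → ℓ ≠ 2 → ¬ (ℓ : ℤ) ∣ A → ¬ 4 ∣ ℓ - 1 → ¬ 7 ∣ ℓ - 1 → ¬ 3 ∣ ℓ - 1 →
        IsSquare ((7 : ℕ) : ZMod ℓ) →
      ∀ χ : DirichletCharacter ℂ ℓ, χ.Odd →
      ∃ L : ℂ → ℂ, Differentiable ℂ L ∧
        (∀ s : ℂ, 2 < s.re → L s = LSeries (fun n : ℕ ↦ χ⁻¹ (n : ZMod ℓ) *
          ((⟨0, 0, 0, (A : ℚ), 0⟩ : WeierstrassCurve ℚ).LFunction n : ℂ)) s) ∧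
        ∃ s : ℕ, ¬ 7 ∣ s ∧ IsIntegral ℤ ((s : ℂ) * (gaussSum χ (ZMod.stdAddChar (N := ℓ)) * L 1 /
          (Complex.I * ((⟨0, 0, 0, (A : ℚ), 0⟩ : WeierstrassCurve ℚ).imaginaryPeriodRat : ℂ))))) :
    ManinDatumSupercuspidalCMInert := by
  intro W _ _ _ p _ D v hv hCM hr _hp57 hin hbad hopt hcell
  rcases hcell with ⟨hp5, hj, hk⟩ | ⟨hp7, hj, hk⟩
  · exact stub_S5_of_modelOddLValues H₅ W p D v hv hCM hr hp5 hj hin hbad hopt hk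
  · exact stub_S7_of_modelOddLValues H₇ W p D v hv hCM hr hp7 hj hin hbad hopt hk

end Summit.BirchSwinnertonDyer.BirchSwinnertonDyer.Theorems.BiquadraticEisensteinDescentManinDatumSupercuspidalCMInertStubsOfModelLValues

end
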